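import Literature.MathematicalPhysics.QuantumFieldTheory.Balaban1983to89.B11Eq26ActionExpansion

/-!
# `Balaban1983to89.B9Eq39TwoBackgroundLetters` — T. Bałaban, *Propagators and renormalization transformations for lattice gauge theories II*, Commun. Math. Phys. **99** (1985) 389–434 [Balaban1985BackgroundPropagators]: (3.1)–(3.5) pp. 390–391 (plaquette variables, transports, covariant curl), with *The variational problem …*, Commun. Math. Phys. **102** (1985) [Balaban1985Variational] (34)–(36) p. 283 (the four scaled letters of `∂p`) — THE LETTERS OF THE V₀-GROUP AT TWO BACKGROUNDS: moduli of the transport `R(U)X = UXU⁻¹`, of the scaled letters `Y_k`, of the plaquette variable `U(∂p)` and of the covariant curl between two unit-bounded backgrounds `U, U′` with `‖U_b − U′_b‖ ≤ δ`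

statement-level skeleton of published theorems with citation tags; proofs where landed; nothing here is a claim about the Yang–Mills mass gap

PDF held: `paper:balaban1985-cmp99-background-propagators` pp. 390–391 and `paper:balaban1985-cmp102-variational-background` p. 283, through the
verbatim transcriptions of `B9Eq39Adjoint` (`R`, `covD`, `curl`, `plaqU`, `lettersA`) and `B11Eq26ActionExpansion` (`Y`).

CITATION HEADER (lean-in-tree rule 2026-08-18).  WHAT IS REPRODUCED: nothing of print is asserted; print compares nothing between two backgrounds.
The pub-balaban NE9 chain's W80 background-modulus line (`B11Eq98W80BackgroundModulus` ∕ `B11Eq98W80ModulusLetterDefects`) leaves ONE modulus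
displayed, the V₀-group's `δ_V` (`‖curV0 ρ τ U Y − curV0 ρ τ U′ Y‖`, a one-carrier statement by `B11Eq80CurrentTwoCarriers.curV0_jetId`); the
V₀-group's currents are built from the letters of THIS file (`B11Eq90V0primeBond` ∕ `B11Eq36Complex` ∕ `B11Eq92CommutatorFunctional`), so their
two-background moduli start here.  These are [folklore] normed-ring identities on the cited letters.

WHAT IS PROVED (sorry-free; axioms standard; 0 def).
§1 `norm_units_inv_sub_inv_le` (`V⁻¹ − V′⁻¹ = V⁻¹(V′ − V)V′⁻¹`, cf. the tree's `B9Eq373V3.units_inv_sub_inv`), **`norm_R_sub_R_le`** (`‖R(V)X − R(V′)X‖ ≤ 2δ‖X‖` for `V, V′` in the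
   unit balls with `‖V − V′‖ ≤ δ`).
§2 **`norm_Y_sub_Y_le`** — the scaled letters `Y_k` ((34): `iη·(−R(U_ν(x))A_μ(x+e_ν), −A_ν(x), A_μ(x), R(U_μ(x))A_ν(x+e_μ))`): `‖Y_k(U) − Y_k(U′)‖ ≤ 2|η|δ·a`
   for `‖A‖ ≤ a` (letters 1, 2 do not see the background); **`norm_plaqU_sub_plaqU_le`** (`‖U(∂p) − U′(∂p)‖ ≤ 4δ`, four-factor telescope);
   **`norm_covD_sub_covD_le`**, **`norm_curl_sub_curl_le`** (`≤ 2δ(‖A_ν(x+e_μ)‖ + ‖A_μ(x+e_ν)‖)`).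

HONEST SCOPE — what is NOT claimed.  (i) Letter algebra only; the moduli of `V′₀`, of its one-bond functionals and of `curV0` are the next files.
(ii) NOT summit progress (cell pub-balaban: NE9 NOT PRINTED ∕ NOT PROVED; «NE9 ⇐ the named binders»; spine PROVED 0/9; HONEST DEPENDENCY: continuum
YM on T⁴ ⇐ BetaPertH ∧ nine spine estimates (0/9 proved); BetaPertH ⇐ (D1) ∧ (D4) ∧ CAP+tail; G-an2-4 gates asym, D1 and NE2/3/4).  Unit
`b2b-balaban-t4-ne9-formalise-leaf-05` (NE9 crux-team leaf prover, gen 70).  Imports `B11Eq26ActionExpansion` ONLY; modifies nothing.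
-/

noncomputable section

open Complex

namespace Literature.MathematicalPhysics.QuantumFieldTheory.Balaban1983to89.B9Eq39TwoBackgroundLetters

open Literature.MathematicalPhysics.QuantumFieldTheory.Balaban1983to89.B9Eq39Adjoint
open Literature.MathematicalPhysics.QuantumFieldTheory.Balaban1983to89.B11Eq26ActionExpansion (Y)

/-! ## §1 Units and the transport letter at two backgrounds -/

section Units

variable {𝔸 : Type*} [NormedRing 𝔸]

/-- `‖V⁻¹ − V′⁻¹‖ ≤ ‖V⁻¹‖·‖V − V′‖·‖V′⁻¹‖` (from `V⁻¹ − V′⁻¹ = V⁻¹(V′ − V)V′⁻¹`, the tree's `B9Eq373V3.units_inv_sub_inv`, re-derived inline to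
keep the import cone at `B11Eq26ActionExpansion`). [folklore] [cite: Balaban1985BackgroundPropagators, (3.5) p.391] -/
theorem norm_units_inv_sub_inv_le (V V' : 𝔸ˣ) :
    ‖((V⁻¹ : 𝔸ˣ) : 𝔸) - ((V'⁻¹ : 𝔸ˣ) : 𝔸)‖ ≤ ‖((V⁻¹ : 𝔸ˣ) : 𝔸)‖ * ‖(V : 𝔸) - (V' : 𝔸)‖ * ‖((V'⁻¹ : 𝔸ˣ) : 𝔸)‖ := by
  have e : ((V⁻¹ : 𝔸ˣ) : 𝔸) - ((V'⁻¹ : 𝔸ˣ) : 𝔸) = ((V⁻¹ : 𝔸ˣ) : 𝔸) * ((V' : 𝔸) - (V : 𝔸)) * ((V'⁻¹ : 𝔸ˣ) : 𝔸) := by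
    rw [mul_sub, sub_mul, mul_assoc ((V⁻¹ : 𝔸ˣ) : 𝔸) (V' : 𝔸), Units.mul_inv, mul_one, Units.inv_mul, one_mul]
  rw [e, ← norm_neg ((V : 𝔸) - V'), neg_sub]
  exact (norm_mul_le _ _).trans (mul_le_mul_of_nonneg_right (norm_mul_le _ _) (norm_nonneg _))

/-- **THE TRANSPORT LETTER AT TWO BACKGROUNDS**: `‖R(V)X − R(V′)X‖ ≤ 2δ·‖X‖` for bond variables in the unit balls (`‖V‖, ‖V⁻¹‖, ‖V′‖, ‖V′⁻¹‖ ≤ 1`)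
with `‖V − V′‖ ≤ δ` — `R(V)X − R(V′)X = (V − V′)XV⁻¹ + V′X(V⁻¹ − V′⁻¹)`. [cite: Balaban1985BackgroundPropagators, (3.3) p.390, (3.5) p.391] -/
theorem norm_R_sub_R_le {V V' : 𝔸ˣ} {δ : ℝ} (hV : ‖(V : 𝔸)‖ ≤ 1 ∧ ‖((V⁻¹ : 𝔸ˣ) : 𝔸)‖ ≤ 1)
    (hV' : ‖(V' : 𝔸)‖ ≤ 1 ∧ ‖((V'⁻¹ : 𝔸ˣ) : 𝔸)‖ ≤ 1) (hδ : ‖(V : 𝔸) - (V' : 𝔸)‖ ≤ δ) (X : 𝔸) :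
    ‖R V X - R V' X‖ ≤ 2 * δ * ‖X‖ := by
  have hδ0 : 0 ≤ δ := (norm_nonneg _).trans hδ
  have e : R V X - R V' X = ((V : 𝔸) - V') * X * ((V⁻¹ : 𝔸ˣ) : 𝔸) + (V' : 𝔸) * X * (((V⁻¹ : 𝔸ˣ) : 𝔸) - ((V'⁻¹ : 𝔸ˣ) : 𝔸)) := by
    simp only [R_def]; noncomm_ring
  rw [e]
  have h1 : ‖((V : 𝔸) - V') * X * ((V⁻¹ : 𝔸ˣ) : 𝔸)‖ ≤ δ * ‖X‖ := by
    calc _ ≤ ‖(V : 𝔸) - V'‖ * ‖X‖ * ‖((V⁻¹ : 𝔸ˣ) : 𝔸)‖ :=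
          (norm_mul_le _ _).trans (mul_le_mul_of_nonneg_right (norm_mul_le _ _) (norm_nonneg _))
      _ ≤ δ * ‖X‖ * 1 := by gcongr; exact hV.2
      _ = δ * ‖X‖ := by ring
  have h2 : ‖(V' : 𝔸) * X * (((V⁻¹ : 𝔸ˣ) : 𝔸) - ((V'⁻¹ : 𝔸ˣ) : 𝔸))‖ ≤ δ * ‖X‖ := by
    have hi : ‖((V⁻¹ : 𝔸ˣ) : 𝔸) - ((V'⁻¹ : 𝔸ˣ) : 𝔸)‖ ≤ δ := by
      refine (norm_units_inv_sub_inv_le V V').trans ?_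
      calc ‖((V⁻¹ : 𝔸ˣ) : 𝔸)‖ * ‖(V : 𝔸) - (V' : 𝔸)‖ * ‖((V'⁻¹ : 𝔸ˣ) : 𝔸)‖ ≤ 1 * δ * 1 := by
            gcongr
            · exact hV.2
            · exact hV'.2
        _ = δ := by ring
    calc _ ≤ ‖(V' : 𝔸)‖ * ‖X‖ * ‖((V⁻¹ : 𝔸ˣ) : 𝔸) - ((V'⁻¹ : 𝔸ˣ) : 𝔸)‖ :=
          (norm_mul_le _ _).trans (mul_le_mul_of_nonneg_right (norm_mul_le _ _) (norm_nonneg _))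
      _ ≤ 1 * ‖X‖ * δ := by gcongr; exact hV'.1
      _ = δ * ‖X‖ := by ring
  calc _ ≤ ‖((V : 𝔸) - V') * X * ((V⁻¹ : 𝔸ˣ) : 𝔸)‖ + ‖(V' : 𝔸) * X * (((V⁻¹ : 𝔸ˣ) : 𝔸) - ((V'⁻¹ : 𝔸ˣ) : 𝔸))‖ := norm_add_le _ _
    _ ≤ δ * ‖X‖ + δ * ‖X‖ := add_le_add h1 h2
    _ = 2 * δ * ‖X‖ := by ring

end Units

/-! ## §2 The plaquette letters at two backgrounds -/

section Letters

variable {𝔸 : Type*} [NormedRing 𝔸] [NormedAlgebra ℂ 𝔸]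
variable {S : Type*} {ι : Type*}
variable (T : ι → Equiv.Perm S) {U U' : ι → S → 𝔸ˣ} {δ : ℝ}

/-- **THE FOUR SCALED LETTERS OF `∂p` AT TWO BACKGROUNDS** ((34): `Y₀ = −iηR(U_ν(x))A_μ(x+e_ν)`, `Y₁ = −iηA_ν(x)`, `Y₂ = iηA_μ(x)`,
`Y₃ = iηR(U_μ(x))A_ν(x+e_μ)`): `‖Y_k(U) − Y_k(U′)‖ ≤ 2|η|δ·a` for every `k`, for backgrounds in the unit balls with `‖U_b − U′_b‖ ≤ δ` and `‖A‖ ≤ a`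
(the letters `Y₁, Y₂` do not see the background). [cite: Balaban1985Variational, (34) p.283; Balaban1985BackgroundPropagators, (3.2) p.390] -/
theorem norm_Y_sub_Y_le (hUn : ∀ μ x, ‖(U μ x : 𝔸)‖ ≤ 1 ∧ ‖(((U μ x)⁻¹ : 𝔸ˣ) : 𝔸)‖ ≤ 1)
    (hUn' : ∀ μ x, ‖(U' μ x : 𝔸)‖ ≤ 1 ∧ ‖(((U' μ x)⁻¹ : 𝔸ˣ) : 𝔸)‖ ≤ 1) (hUU' : ∀ μ x, ‖(U μ x : 𝔸) - (U' μ x : 𝔸)‖ ≤ δ)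
    (η : ℝ) {A : ι → S → 𝔸} {a : ℝ} (hA : ∀ μ x, ‖A μ x‖ ≤ a) (μ ν : ι) (x : S) (k : Fin 4) :
    ‖Y T U η A μ ν x k - Y T U' η A μ ν x k‖ ≤ 2 * |η| * δ * a := by
  have hδ0 : 0 ≤ δ := (norm_nonneg _).trans (hUU' μ x)
  have ha0 : 0 ≤ a := (norm_nonneg _).trans (hA μ x)
  have hIη : ‖(I * η : ℂ)‖ = |η| := by rw [norm_mul, norm_I, one_mul, norm_real, Real.norm_eq_abs]
  have hR : ∀ (κ κ' : ι) (y z : S), ‖(I * η : ℂ) • R (U κ y) (A κ' z) - (I * η : ℂ) • R (U' κ y) (A κ' z)‖ ≤ 2 * |η| * δ * a := by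
    intro κ κ' y z
    rw [← smul_sub, norm_smul, hIη]
    calc |η| * ‖R (U κ y) (A κ' z) - R (U' κ y) (A κ' z)‖ ≤ |η| * (2 * δ * ‖A κ' z‖) :=
          mul_le_mul_of_nonneg_left (norm_R_sub_R_le (hUn κ y) (hUn' κ y) (hUU' κ y) _) (abs_nonneg η)
      _ ≤ |η| * (2 * δ * a) := by gcongr; exact hA κ' z
      _ = 2 * |η| * δ * a := by ring
  have h0 : (0 : ℝ) ≤ 2 * |η| * δ * a := by positivity
  fin_cases k
  · change ‖(I * η : ℂ) • (-(R (U ν x) (A μ (T ν x)))) - (I * η : ℂ) • (-(R (U' ν x) (A μ (T ν x))))‖ ≤ _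
    rw [smul_neg, smul_neg, neg_sub_neg, norm_sub_rev]
    exact hR ν μ x (T ν x)
  · change ‖(I * η : ℂ) • (-(A ν x)) - (I * η : ℂ) • (-(A ν x))‖ ≤ _
    rw [sub_self, norm_zero]; exact h0
  · change ‖(I * η : ℂ) • A μ x - (I * η : ℂ) • A μ x‖ ≤ _
    rw [sub_self, norm_zero]; exact h0
  · change ‖(I * η : ℂ) • R (U μ x) (A ν (T μ x)) - (I * η : ℂ) • R (U' μ x) (A ν (T μ x))‖ ≤ _
    exact hR μ ν x (T μ x)

omit [NormedAlgebra ℂ 𝔸] in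
/-- **THE PLAQUETTE VARIABLE AT TWO BACKGROUNDS**: `‖U(∂p) − U′(∂p)‖ ≤ 4δ` (`U(∂p) = U_μ(x)U_ν(x+e_μ)U_μ(x+e_ν)⁻¹U_ν(x)⁻¹`, four factors in the unit
balls, each within `δ` of its twin — the inverses by `norm_units_inv_sub_inv_le`). [cite: Balaban1985BackgroundPropagators, (3.1) p.390, (3.5) p.391] -/
theorem norm_plaqU_sub_plaqU_le (hUn : ∀ μ x, ‖(U μ x : 𝔸)‖ ≤ 1 ∧ ‖(((U μ x)⁻¹ : 𝔸ˣ) : 𝔸)‖ ≤ 1)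
    (hUn' : ∀ μ x, ‖(U' μ x : 𝔸)‖ ≤ 1 ∧ ‖(((U' μ x)⁻¹ : 𝔸ˣ) : 𝔸)‖ ≤ 1) (hUU' : ∀ μ x, ‖(U μ x : 𝔸) - (U' μ x : 𝔸)‖ ≤ δ)
    (μ ν : ι) (x : S) :
    ‖(plaqU T U μ ν x : 𝔸) - (plaqU T U' μ ν x : 𝔸)‖ ≤ 4 * δ := by
  have hδ0 : 0 ≤ δ := (norm_nonneg _).trans (hUU' μ x)
  -- the four factors and their twins
  set a := (U μ x : 𝔸); set b := (U ν (T μ x) : 𝔸); set c := (((U μ (T ν x))⁻¹ : 𝔸ˣ) : 𝔸); set d := (((U ν x)⁻¹ : 𝔸ˣ) : 𝔸)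
  set a' := (U' μ x : 𝔸); set b' := (U' ν (T μ x) : 𝔸); set c' := (((U' μ (T ν x))⁻¹ : 𝔸ˣ) : 𝔸); set d' := (((U' ν x)⁻¹ : 𝔸ˣ) : 𝔸)
  have hinv : ∀ κ y, ‖(((U κ y)⁻¹ : 𝔸ˣ) : 𝔸) - (((U' κ y)⁻¹ : 𝔸ˣ) : 𝔸)‖ ≤ δ := fun κ y => by
    refine (norm_units_inv_sub_inv_le (U κ y) (U' κ y)).trans ?_
    calc _ ≤ 1 * δ * 1 := by
          gcongr
          · exact (hUn κ y).2
          · exact hUU' κ y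
          · exact (hUn' κ y).2
      _ = δ := by ring
  have ha : ‖a - a'‖ ≤ δ := hUU' μ x
  have hb : ‖b - b'‖ ≤ δ := hUU' ν (T μ x)
  have hc : ‖c - c'‖ ≤ δ := hinv μ (T ν x)
  have hd : ‖d - d'‖ ≤ δ := hinv ν x
  have na' : ‖a'‖ ≤ 1 := (hUn' μ x).1
  have nb : ‖b‖ ≤ 1 := (hUn ν (T μ x)).1
  have nb' : ‖b'‖ ≤ 1 := (hUn' ν (T μ x)).1
  have nc : ‖c‖ ≤ 1 := (hUn μ (T ν x)).2
  have nc' : ‖c'‖ ≤ 1 := (hUn' μ (T ν x)).2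
  have nd : ‖d‖ ≤ 1 := (hUn ν x).2
  have e : (plaqU T U μ ν x : 𝔸) - (plaqU T U' μ ν x : 𝔸) =
      (a - a') * b * c * d + a' * (b - b') * c * d + a' * b' * (c - c') * d + a' * b' * c' * (d - d') := by
    simp only [plaqU, Units.val_mul, a, b, c, d, a', b', c', d']; noncomm_ring
  rw [e]
  have t1 : ‖(a - a') * b * c * d‖ ≤ δ := by
    calc _ ≤ ‖a - a'‖ * ‖b‖ * ‖c‖ * ‖d‖ := by
          refine (norm_mul_le _ _).trans (mul_le_mul_of_nonneg_right ((norm_mul_le _ _).trans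
            (mul_le_mul_of_nonneg_right (norm_mul_le _ _) (norm_nonneg _))) (norm_nonneg _))
      _ ≤ δ * 1 * 1 * 1 := by gcongr
      _ = δ := by ring
  have t2 : ‖a' * (b - b') * c * d‖ ≤ δ := by
    calc _ ≤ ‖a'‖ * ‖b - b'‖ * ‖c‖ * ‖d‖ := by
          refine (norm_mul_le _ _).trans (mul_le_mul_of_nonneg_right ((norm_mul_le _ _).trans
            (mul_le_mul_of_nonneg_right (norm_mul_le _ _) (norm_nonneg _))) (norm_nonneg _))
      _ ≤ 1 * δ * 1 * 1 := by gcongr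
      _ = δ := by ring
  have t3 : ‖a' * b' * (c - c') * d‖ ≤ δ := by
    calc _ ≤ ‖a'‖ * ‖b'‖ * ‖c - c'‖ * ‖d‖ := by
          refine (norm_mul_le _ _).trans (mul_le_mul_of_nonneg_right ((norm_mul_le _ _).trans
            (mul_le_mul_of_nonneg_right (norm_mul_le _ _) (norm_nonneg _))) (norm_nonneg _))
      _ ≤ 1 * 1 * δ * 1 := by gcongr
      _ = δ := by ring
  have t4 : ‖a' * b' * c' * (d - d')‖ ≤ δ := by
    calc _ ≤ ‖a'‖ * ‖b'‖ * ‖c'‖ * ‖d - d'‖ := by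
          refine (norm_mul_le _ _).trans (mul_le_mul_of_nonneg_right ((norm_mul_le _ _).trans
            (mul_le_mul_of_nonneg_right (norm_mul_le _ _) (norm_nonneg _))) (norm_nonneg _))
      _ ≤ 1 * 1 * 1 * δ := by gcongr
      _ = δ := by ring
  have s3 := norm_add_le ((a - a') * b * c * d + a' * (b - b') * c * d + a' * b' * (c - c') * d) (a' * b' * c' * (d - d'))
  have s2 := norm_add_le ((a - a') * b * c * d + a' * (b - b') * c * d) (a' * b' * (c - c') * d)
  have s1 := norm_add_le ((a - a') * b * c * d) (a' * (b - b') * c * d)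
  linarith

omit [NormedAlgebra ℂ 𝔸] in
/-- **THE COVARIANT DERIVATIVE AT TWO BACKGROUNDS**: `‖(D_{U,μ}f)(x) − (D_{U′,μ}f)(x)‖ ≤ 2δ·‖f(x+e_μ)‖` ((3.3): only the transport sees the
background). [cite: Balaban1985BackgroundPropagators, (3.3) p.390] -/
theorem norm_covD_sub_covD_le (hUn : ∀ μ x, ‖(U μ x : 𝔸)‖ ≤ 1 ∧ ‖(((U μ x)⁻¹ : 𝔸ˣ) : 𝔸)‖ ≤ 1)
    (hUn' : ∀ μ x, ‖(U' μ x : 𝔸)‖ ≤ 1 ∧ ‖(((U' μ x)⁻¹ : 𝔸ˣ) : 𝔸)‖ ≤ 1) (hUU' : ∀ μ x, ‖(U μ x : 𝔸) - (U' μ x : 𝔸)‖ ≤ δ)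
    (μ : ι) (f : S → 𝔸) (x : S) :
    ‖covD T U μ f x - covD T U' μ f x‖ ≤ 2 * δ * ‖f (T μ x)‖ := by
  have e : covD T U μ f x - covD T U' μ f x = R (U μ x) (f (T μ x)) - R (U' μ x) (f (T μ x)) := by
    simp only [covD]; abel
  rw [e]
  exact norm_R_sub_R_le (hUn μ x) (hUn' μ x) (hUU' μ x) _

omit [NormedAlgebra ℂ 𝔸] in
/-- **THE COVARIANT CURL AT TWO BACKGROUNDS**: `‖(D_U A)(p_{μν}(x)) − (D_{U′} A)(p_{μν}(x))‖ ≤ 2δ·(‖A_ν(x+e_μ)‖ + ‖A_μ(x+e_ν)‖)` ((3.4)).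
[cite: Balaban1985BackgroundPropagators, (3.4) p.391] -/
theorem norm_curl_sub_curl_le (hUn : ∀ μ x, ‖(U μ x : 𝔸)‖ ≤ 1 ∧ ‖(((U μ x)⁻¹ : 𝔸ˣ) : 𝔸)‖ ≤ 1)
    (hUn' : ∀ μ x, ‖(U' μ x : 𝔸)‖ ≤ 1 ∧ ‖(((U' μ x)⁻¹ : 𝔸ˣ) : 𝔸)‖ ≤ 1) (hUU' : ∀ μ x, ‖(U μ x : 𝔸) - (U' μ x : 𝔸)‖ ≤ δ)
    (A : ι → S → 𝔸) (μ ν : ι) (x : S) :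
    ‖curl T U A μ ν x - curl T U' A μ ν x‖ ≤ 2 * δ * (‖A ν (T μ x)‖ + ‖A μ (T ν x)‖) := by
  have e : curl T U A μ ν x - curl T U' A μ ν x =
      (covD T U μ (A ν) x - covD T U' μ (A ν) x) - (covD T U ν (A μ) x - covD T U' ν (A μ) x) := by
    simp only [curl]; abel
  rw [e, mul_add]
  exact (norm_sub_le _ _).trans (add_le_add (norm_covD_sub_covD_le T hUn hUn' hUU' μ (A ν) x)
    (norm_covD_sub_covD_le T hUn hUn' hUU' ν (A μ) x))

end Letters

end Literature.MathematicalPhysics.QuantumFieldTheory.Balaban1983to89.B9Eq39TwoBackgroundLetters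

end
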